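import Summits.AtomisticToContinuum.BoseEinsteinCondensation.Theorems.BECInsertionCorrectorStaticResponseBoundModulationTwoPoint
import Summits.AtomisticToContinuum.BoseEinsteinCondensation.Theorems.BECInsertionCorrectorStaticResponseBoundFreeSquare
import HarnessLib

/-!
# The few-body half of the static response bound, I: variational second-order perturbation theory
# for one real component (line `stable-fraction-square-completion`, seat c2 layer; item stmt-AtomisticToContinuum-12057)

Support file for the lead's registered stub `stub_fewBodyBounded_of_parts` of crux
`BECInsertionCorrector.StaticResponseBound` (this file supports, does not close, the item).

Setting: `Φ > 0` a real `C¹` periodic trial state of finite energy minimising `E_w` among finite-energy states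
(value `λ`), `F = |Φ|`, `μ = F² dX` (a probability measure on the cell), `V = ∑ⱼ cos(p·xⱼ)`, `p = 2πk/L`,
`𝓔(θ) = dirichletFormW L F θ θ = ∫ |∇θ|² dμ`.  For a real `C¹` lattice-periodic Bose-symmetric `θ` write `θ = a + η`
with `a = ∫ θ dμ`, `∫ η dμ = 0`.  Given
* the GAP `((2π/L)² − 2λ) ∫η² dμ ≤ 𝓔(η)` for `μ`-mean-zero `η` (registered stub `stub_weightedGap`), and
* the MODE PAIRING bound `|p|² |∫ V η dμ| ≤ √(N|p|²) (𝓔(η)^{1/2} + 2 ‖η‖_μ ‖∇F‖₂)` (registered stub `stub_modePairing`),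
both taken here as hypotheses about this `Φ`, and the sign condition `t·⟨V⟩_Φ ≥ 0`, we prove for
`5λ ≤ (2π/L)²` and `2|t|N ≤ (2π/L)² − 2λ`:

  `𝓔(θ) + t ∫ V θ² dμ ≥ −10 t² (N/|p|²) ∫ θ² dμ`        (`fewBody_perturbative_real`).

The analysis is reduced to a purely algebraic lemma (`fewBody_algebraic_core`): with `D = 𝓔(η)`, `m = ∫η²dμ`,
`P = ∫Vη dμ`, `Q = ∫Vη² dμ`, `S = ∫V dμ`, `T₀ = ∫|∇F|² ≤ λ ≤ g/3`, `g m ≤ D`, `|Q| ≤ N m`, `2|t|N ≤ g`: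
`|p|² P² ≤ 5 N D` (square the pairing bound, `(u + 2r)² ≤ 5u²` when `3r² ≤ u²`), `tQ ≥ −D/2`, `2taP ≥ −(D/2 + 10t²a²N/|p|²)`
(AM–GM), `t a² S ≥ 0`; summing, `D + t(a²S + 2aP + Q) ≥ −10 t² a² N/|p|²`, and `a² ≤ ∫θ²dμ`.

References: [ReedSimonIV1978] §XII.1–2 (Rayleigh–Schrödinger series; here in variational, remainder-free form);
[Kato1966] VII §4 (second-order bounds). Everything below is folklore real analysis on the torus cell.
-/

noncomputable section

namespace Summit.AtomisticToContinuum.BoseEinsteinCondensation.Cruxes.StaticResponseBound.FewBody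

open MeasureTheory Filter
open scoped ENNReal NNReal BigOperators Topology
open Literature.MathematicalPhysics.QuantumManyBody.BoseGas
open Summit.AtomisticToContinuum.BoseEinsteinCondensation.Theses.BECInsertionCorrector
open Summit.AtomisticToContinuum.BoseEinsteinCondensation.Theorems.StaticResponseBound.Negative
open Summit.AtomisticToContinuum.BoseEinsteinCondensation.Cruxes.StaticResponseBound.UvThomsonForceWave

variable {N : ℕ} {L : ℝ}

/-! ## The algebraic core -/

/-- `(u + 2r)² ≤ 5u²` whenever `3r² ≤ u²` (from `(u − 2r)² ≥ 0`). [folklore] -/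
theorem sq_add_two_mul_le {u r : ℝ} (h : 3 * r ^ 2 ≤ u ^ 2) :
    (u + 2 * r) ^ 2 ≤ 5 * u ^ 2 := by
  nlinarith [sq_nonneg (u - 2 * r)]

/-- **The algebraic core of second-order perturbation theory in the few-body regime.** With the dictionary of the
file header: the pairing bound squared gives `|p|² P² ≤ 5 N D`; then `D + t(a²S + 2aP + Q) ≥ −10 t² a² N/|p|²`.
[folklore] -/
theorem fewBody_algebraic_core {D m P Q S a t Nr psq g T₀ lam : ℝ}
    (hD : 0 ≤ D) (hm : 0 ≤ m) (hgap : g * m ≤ D) (hpsq : 0 < psq) (hN : 0 < Nr)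
    (hpair : psq * |P| ≤ Real.sqrt (Nr * psq) * (Real.sqrt D + 2 * Real.sqrt m * Real.sqrt T₀))
    (hT0 : 0 ≤ T₀) (hT0lam : T₀ ≤ lam) (hlam : 3 * lam ≤ g) (hQ : |Q| ≤ Nr * m) (hS : 0 ≤ t * S)
    (ht : 2 * |t| * Nr ≤ g) :
    -(10 * t ^ 2 * Nr / psq) * a ^ 2 ≤ D + t * (a ^ 2 * S + 2 * a * P + Q) := by
  have hg : 0 < g ∨ g ≤ 0 := lt_or_ge 0 g
  -- Step 1: `psq * P² ≤ 5 Nr D`.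
  set u : ℝ := Real.sqrt D with hu
  set r : ℝ := Real.sqrt m * Real.sqrt T₀ with hr
  have hu2 : u ^ 2 = D := Real.sq_sqrt hD
  have hr2 : r ^ 2 = m * T₀ := by
    rw [hr, mul_pow, Real.sq_sqrt hm, Real.sq_sqrt hT0]
  -- `3 m T₀ ≤ D`: `m ≤ D/g`, `T₀ ≤ g/3` (if `g ≤ 0` then `m T₀`… handle via cases)
  have h3r : 3 * r ^ 2 ≤ u ^ 2 := by
    rw [hr2, hu2]
    rcases hg with hgpos | hgnp
    · -- `3 T₀ ≤ g` and `g m ≤ D`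
      have h1 : 3 * T₀ ≤ g := by linarith
      calc 3 * (m * T₀) = m * (3 * T₀) := by ring
        _ ≤ m * g := mul_le_mul_of_nonneg_left h1 hm
        _ = g * m := by ring
        _ ≤ D := hgap
    · -- `g ≤ 0` forces `T₀ ≤ lam ≤ g/3 ≤ 0`, so `T₀ = 0`
      have hT00 : T₀ = 0 := le_antisymm (by linarith) hT0
      rw [hT00, mul_zero, mul_zero]
      exact hD
  have hstep : (u + 2 * r) ^ 2 ≤ 5 * u ^ 2 := sq_add_two_mul_le h3r
  have hpair' : psq * |P| ≤ Real.sqrt (Nr * psq) * (u + 2 * r) := by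
    simpa [hu, hr, mul_assoc] using hpair
  have hNp : 0 ≤ Nr * psq := by positivity
  have hP2 : psq * P ^ 2 ≤ 5 * Nr * D := by
    have h0 : 0 ≤ psq * |P| := by positivity
    have hsq : (psq * |P|) ^ 2 ≤ (Real.sqrt (Nr * psq) * (u + 2 * r)) ^ 2 :=
      pow_le_pow_left₀ h0 hpair' 2
    rw [mul_pow, mul_pow, Real.sq_sqrt hNp, sq_abs] at hsq
    -- `psq² P² ≤ Nr psq (u+2r)² ≤ Nr psq 5 u² = 5 Nr psq D`
    have h2 : Nr * psq * (u + 2 * r) ^ 2 ≤ Nr * psq * (5 * u ^ 2) :=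
      mul_le_mul_of_nonneg_left hstep hNp
    rw [hu2] at h2
    have h3 : psq * (psq * P ^ 2) ≤ psq * (5 * Nr * D) := by nlinarith
    exact le_of_mul_le_mul_left h3 hpsq
  -- Step 2: the three elementary bounds.
  have h1 : 0 ≤ t * (a ^ 2 * S) := by
    have : t * (a ^ 2 * S) = a ^ 2 * (t * S) := by ring
    rw [this]; exact mul_nonneg (sq_nonneg a) hS
  have h2 : -(D / 2) ≤ t * Q := by
    -- `|tQ| ≤ |t| Nr m ≤ (g/2) m ≤ D/2`
    have hab : |t * Q| ≤ |t| * (Nr * m) := by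
      rw [abs_mul]; exact mul_le_mul_of_nonneg_left hQ (abs_nonneg t)
    have hb : |t| * (Nr * m) ≤ D / 2 := by
      have : |t| * (Nr * m) = (2 * |t| * Nr) * m / 2 := by ring
      rw [this]
      have := mul_le_mul_of_nonneg_right ht hm
      linarith
    have := neg_abs_le (t * Q)
    linarith
  have h3 : -(D / 2 + 10 * t ^ 2 * Nr / psq * a ^ 2) ≤ 2 * a * P * t := by
    -- AM–GM: `(2taP)² = 4t²a²P² ≤ 4 t²a² (5 Nr D/psq) = 4 (D/2)(10 t² a² Nr/psq) ≤ (D/2 + 10t²a²Nr/psq)²`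
    have hB : 0 ≤ D / 2 + 10 * t ^ 2 * Nr / psq * a ^ 2 := by positivity
    have hsq : (2 * a * P * t) ^ 2 ≤ (D / 2 + 10 * t ^ 2 * Nr / psq * a ^ 2) ^ 2 := by
      have e1 : (2 * a * P * t) ^ 2 = 4 * (t ^ 2 * a ^ 2) * P ^ 2 := by ring
      have hta : 0 ≤ t ^ 2 * a ^ 2 := by positivity
      have hP2' : P ^ 2 ≤ 5 * Nr * D / psq := by
        rw [le_div_iff₀ hpsq]; linarith
      calc (2 * a * P * t) ^ 2 = 4 * (t ^ 2 * a ^ 2) * P ^ 2 := e1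
        _ ≤ 4 * (t ^ 2 * a ^ 2) * (5 * Nr * D / psq) :=
            mul_le_mul_of_nonneg_left hP2' (by positivity)
        _ = 4 * (D / 2) * (10 * t ^ 2 * Nr / psq * a ^ 2) := by ring
        _ ≤ (D / 2 + 10 * t ^ 2 * Nr / psq * a ^ 2) ^ 2 := by
            nlinarith [sq_nonneg (D / 2 - 10 * t ^ 2 * Nr / psq * a ^ 2)]
    have hh := abs_le_of_sq_le_sq' hsq hB
    linarith [hh.1]
  -- Step 3: sum up.
  have e : D + t * (a ^ 2 * S + 2 * a * P + Q) = D + t * (a ^ 2 * S) + 2 * a * P * t + t * Q := by ring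
  rw [e]
  linarith

/-! ## One real component -/

section OneComponent

variable {w : ℝ → ℝ≥0∞} {Φ : PeriodicTrialState N L}

/-- `a² ≤ ∫ θ² dμ` and `∫ (θ - a)² dμ = ∫ θ² dμ - a²` for the `μ = F²dX`-mean `a = ∫ θ dμ` (`∫ F² = 1`). [folklore] -/
theorem integral_sub_mean_sq_mul (Φ : PeriodicTrialState N L) (hreal : ∀ X, Φ.ψ X = (‖Φ.ψ X‖ : ℂ))
    {θ : Config N → ℝ} (hθ : Continuous θ) :
    ∫ X in cellN N L, (θ X - ∫ Y in cellN N L, θ Y * ‖Φ.ψ Y‖ ^ 2) ^ 2 * ‖Φ.ψ X‖ ^ 2 =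
      (∫ X in cellN N L, θ X ^ 2 * ‖Φ.ψ X‖ ^ 2) - (∫ Y in cellN N L, θ Y * ‖Φ.ψ Y‖ ^ 2) ^ 2 := by
  set a : ℝ := ∫ Y in cellN N L, θ Y * ‖Φ.ψ Y‖ ^ 2 with ha
  have hFc : Continuous fun X => ‖Φ.ψ X‖ := (contDiff_norm_of_real Φ hreal).continuous
  have hF2c : Continuous fun X => ‖Φ.ψ X‖ ^ 2 := hFc.pow 2
  have i1 : IntegrableOn (fun X => θ X ^ 2 * ‖Φ.ψ X‖ ^ 2) (cellN N L) :=
    integrableOn_cellN ((hθ.pow 2).mul hF2c) L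
  have i2 : IntegrableOn (fun X => θ X * ‖Φ.ψ X‖ ^ 2) (cellN N L) := integrableOn_cellN (hθ.mul hF2c) L
  have i3 : IntegrableOn (fun X => ‖Φ.ψ X‖ ^ 2) (cellN N L) := integrableOn_cellN hF2c L
  have hexp : ∀ X, (θ X - a) ^ 2 * ‖Φ.ψ X‖ ^ 2 =
      θ X ^ 2 * ‖Φ.ψ X‖ ^ 2 - 2 * a * (θ X * ‖Φ.ψ X‖ ^ 2) + a ^ 2 * ‖Φ.ψ X‖ ^ 2 := fun X => by ring
  have i12 : IntegrableOn (fun X => θ X ^ 2 * ‖Φ.ψ X‖ ^ 2 - 2 * a * (θ X * ‖Φ.ψ X‖ ^ 2)) (cellN N L) :=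
    i1.sub (i2.const_mul _)
  simp_rw [hexp]
  rw [integral_add i12 (i3.const_mul _), integral_sub i1 (i2.const_mul _),
    integral_const_mul, integral_const_mul, integral_norm_sq_eq_one Φ, ← ha]
  ring

/-- **Second-order perturbation theory for one real component (few-body regime).**  Let `Φ > 0` be a real
finite-energy periodic trial state (`F = |Φ|`, `λ = E_w(Φ)`), `V = ∑ⱼcos(p·xⱼ)` with `k ≠ 0`, and assume, for this
`Φ`: the weighted gap `((2π/L)² − 2λ)∫η²F² ≤ 𝓔_F(η)` for all `F²`-mean-zero periodic symmetric tests `η`, the mode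
pairing bound `|p|²|∫VηF²| ≤ √(N|p|²)(𝓔_F(η)^{1/2} + 2(∫η²F²)^{1/2}(∫|∇F|²)^{1/2})` for all periodic tests `η`, the
sign condition `t⟨V⟩_Φ ≥ 0`, the few-body condition `5λ ≤ (2π/L)²` and the weak-coupling condition
`2|t|N ≤ (2π/L)² − 2λ`.  Then for every real `C¹` lattice-periodic Bose-symmetric `θ`:
`𝓔_F(θ) + t∫Vθ²F² ≥ −10 t² (N/|p|²) ∫θ²F²`.  [cite: ReedSimonIV1978, §XII.2; Kato1966, VII §4] -/
theorem fewBody_perturbative_real (hL : 0 < L) (hw : Measurable w)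
    (hreal : ∀ X, Φ.ψ X = (‖Φ.ψ X‖ : ℂ)) (hpos : ∀ X, Φ.ψ X ≠ 0) (hfin : periodicEnergy w Φ ≠ ⊤)
    {k : Fin 3 → ℤ} (hk : k ≠ 0) (hN : 0 < N) {t : ℝ}
    (hgap : ∀ η : Config N → ℝ, IsPeriodicTest L η →
      (∀ (σ : Equiv.Perm (Fin N)) (X : Config N), η (X ∘ σ) = η X) →
      (∫ X in cellN N L, η X * ‖Φ.ψ X‖ ^ 2) = 0 →
      ((2 * Real.pi / L) ^ 2 - 2 * (periodicEnergy w Φ).toReal) *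
          ∫ X in cellN N L, η X ^ 2 * ‖Φ.ψ X‖ ^ 2 ≤ dirichletFormW L (fun X => ‖Φ.ψ X‖) η η)
    (hpair : ∀ η : Config N → ℝ, IsPeriodicTest L η →
      psq L k * |∫ X in cellN N L,
          (∑ j, Real.cos (2 * Real.pi / L * ∑ i, (k i : ℝ) * X j i)) * η X * ‖Φ.ψ X‖ ^ 2|
        ≤ Real.sqrt (N * psq L k) * (Real.sqrt (dirichletFormW L (fun X => ‖Φ.ψ X‖) η η) +
            2 * Real.sqrt (∫ X in cellN N L, η X ^ 2 * ‖Φ.ψ X‖ ^ 2) *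
              Real.sqrt (∫ X in cellN N L, gradDot (fun Y => ‖Φ.ψ Y‖) (fun Y => ‖Φ.ψ Y‖) X)))
    (hsign : 0 ≤ t * cosMean L k Φ)
    (hlam : 5 * (periodicEnergy w Φ).toReal ≤ (2 * Real.pi / L) ^ 2)
    (ht : 2 * |t| * N ≤ (2 * Real.pi / L) ^ 2 - 2 * (periodicEnergy w Φ).toReal)
    {θ : Config N → ℝ} (hθ : IsPeriodicTest L θ)
    (hθsymm : ∀ (σ : Equiv.Perm (Fin N)) (X : Config N), θ (X ∘ σ) = θ X) :
    -(10 * t ^ 2 * N / psq L k) * ∫ X in cellN N L, θ X ^ 2 * ‖Φ.ψ X‖ ^ 2 ≤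
      dirichletFormW L (fun X => ‖Φ.ψ X‖) θ θ +
        t * ∫ X in cellN N L,
          (∑ j, Real.cos (2 * Real.pi / L * ∑ i, (k i : ℝ) * X j i)) * θ X ^ 2 * ‖Φ.ψ X‖ ^ 2 := by
  -- notation and regularity
  set V : Config N → ℝ := fun X => ∑ j, Real.cos (2 * Real.pi / L * ∑ i, (k i : ℝ) * X j i) with hVdef
  set a : ℝ := ∫ Y in cellN N L, θ Y * ‖Φ.ψ Y‖ ^ 2 with ha
  set lam : ℝ := (periodicEnergy w Φ).toReal with hlamdef
  have hF : ContDiff ℝ 1 fun X => ‖Φ.ψ X‖ := contDiff_norm_of_real Φ hreal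
  have hFc : Continuous fun X => ‖Φ.ψ X‖ := hF.continuous
  have hF2c : Continuous fun X => ‖Φ.ψ X‖ ^ 2 := hFc.pow 2
  have hθc : Continuous θ := hθ.continuous
  have hVc : Continuous V := by
    simp only [hVdef]
    fun_prop
  have hVabs : ∀ X, |V X| ≤ N := fun X => abs_sum_cos_le L k X
  have hP : 0 < psq L k := freeSq_psq_pos hL hk
  have hNr : (0 : ℝ) < N := by exact_mod_cast hN
  -- the centred component `η = θ - a`
  set η : Config N → ℝ := fun X => θ X - a with hηdef
  have hη : IsPeriodicTest L η := hθ.sub (IsPeriodicTest.const L a)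
  have hηc : Continuous η := hη.continuous
  have hηsymm : ∀ (σ : Equiv.Perm (Fin N)) (X : Config N), η (X ∘ σ) = η X := fun σ X => by
    simp only [hηdef, hθsymm σ X]
  -- integrability of everything in sight (continuous integrands on the bounded cell)
  have iθF : IntegrableOn (fun X => θ X * ‖Φ.ψ X‖ ^ 2) (cellN N L) := integrableOn_cellN (hθc.mul hF2c) L
  have iF : IntegrableOn (fun X => ‖Φ.ψ X‖ ^ 2) (cellN N L) := integrableOn_cellN hF2c L
  have iηF : IntegrableOn (fun X => η X * ‖Φ.ψ X‖ ^ 2) (cellN N L) := integrableOn_cellN (hηc.mul hF2c) L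
  have iη2F : IntegrableOn (fun X => η X ^ 2 * ‖Φ.ψ X‖ ^ 2) (cellN N L) :=
    integrableOn_cellN ((hηc.pow 2).mul hF2c) L
  have iVF : IntegrableOn (fun X => V X * ‖Φ.ψ X‖ ^ 2) (cellN N L) := integrableOn_cellN (hVc.mul hF2c) L
  have iVηF : IntegrableOn (fun X => V X * η X * ‖Φ.ψ X‖ ^ 2) (cellN N L) :=
    integrableOn_cellN ((hVc.mul hηc).mul hF2c) L
  have iVη2F : IntegrableOn (fun X => V X * η X ^ 2 * ‖Φ.ψ X‖ ^ 2) (cellN N L) :=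
    integrableOn_cellN ((hVc.mul (hηc.pow 2)).mul hF2c) L
  -- `∫ η F² = 0`
  have hη0 : ∫ X in cellN N L, η X * ‖Φ.ψ X‖ ^ 2 = 0 := by
    have hexp : ∀ X, η X * ‖Φ.ψ X‖ ^ 2 = θ X * ‖Φ.ψ X‖ ^ 2 - a * ‖Φ.ψ X‖ ^ 2 := fun X => by
      simp only [hηdef]; ring
    simp_rw [hexp]
    rw [integral_sub iθF (iF.const_mul a), integral_const_mul, integral_norm_sq_eq_one Φ, ← ha]
    ring
  -- the quantities of the algebraic core
  set D : ℝ := dirichletFormW L (fun X => ‖Φ.ψ X‖) η η with hDdef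
  set m : ℝ := ∫ X in cellN N L, η X ^ 2 * ‖Φ.ψ X‖ ^ 2 with hmdef
  set P : ℝ := ∫ X in cellN N L, V X * η X * ‖Φ.ψ X‖ ^ 2 with hPdef
  set Q : ℝ := ∫ X in cellN N L, V X * η X ^ 2 * ‖Φ.ψ X‖ ^ 2 with hQdef
  set S : ℝ := ∫ X in cellN N L, V X * ‖Φ.ψ X‖ ^ 2 with hSdef
  set T₀ : ℝ := ∫ X in cellN N L, gradDot (fun Y => ‖Φ.ψ Y‖) (fun Y => ‖Φ.ψ Y‖) X with hT₀def
  set g : ℝ := (2 * Real.pi / L) ^ 2 - 2 * lam with hgdef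
  have hD : 0 ≤ D := dirichletFormW_self_nonneg L _ η
  have hm : 0 ≤ m := setIntegral_nonneg (measurableSet_cellN N L) fun X _ => by positivity
  have hgapη : g * m ≤ D := hgap η hη hηsymm hη0
  have hpairη : psq L k * |P| ≤ Real.sqrt (N * psq L k) * (Real.sqrt D + 2 * Real.sqrt m * Real.sqrt T₀) :=
    hpair η hη
  -- `T₀ ≤ λ = T₀ + ∫ W F²`
  have hT0 : 0 ≤ T₀ := setIntegral_nonneg (measurableSet_cellN N L) fun X _ => gradDot_self_nonneg _ X
  have hΦ1 : ∀ X, Φ.ψ X = (((1 : ℝ) * ‖Φ.ψ X‖ : ℝ) : ℂ) := fun X => by rw [one_mul]; exact hreal X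
  have hT0lam : T₀ ≤ lam := by
    have h := toReal_periodicEnergy_of_eq_mul hw hreal hpos hfin Φ contDiff_const hΦ1
    simp only [one_mul] at h
    rw [hlamdef, h]
    have : 0 ≤ ∫ X in cellN N L, (periodicInteraction w L X).toReal * ‖Φ.ψ X‖ ^ 2 :=
      setIntegral_nonneg (measurableSet_cellN N L) fun X _ =>
        mul_nonneg ENNReal.toReal_nonneg (sq_nonneg _)
    linarith
  have hlam3 : 3 * lam ≤ g := by rw [hgdef]; linarith
  -- `|Q| ≤ N m`
  have hQ : |Q| ≤ N * m := by
    have hbound : ∀ᵐ X ∂(volume.restrict (cellN N L)),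
        ‖V X * η X ^ 2 * ‖Φ.ψ X‖ ^ 2‖ ≤ (N : ℝ) * (η X ^ 2 * ‖Φ.ψ X‖ ^ 2) := by
      refine ae_of_all _ fun X => ?_
      rw [Real.norm_eq_abs, abs_mul, abs_mul, abs_of_nonneg (sq_nonneg (η X)),
        abs_of_nonneg (sq_nonneg ‖Φ.ψ X‖), mul_assoc]
      exact mul_le_mul_of_nonneg_right (hVabs X) (by positivity)
    have h := norm_integral_le_of_norm_le (iη2F.const_mul (N : ℝ)) hbound
    rw [integral_const_mul, Real.norm_eq_abs] at h
    exact h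
  -- the sign term: `S = ⟨V⟩_Φ`
  have hS : 0 ≤ t * S := by
    have : S = cosMean L k Φ := rfl
    rw [this]; exact hsign
  have ht' : 2 * |t| * N ≤ g := ht
  -- the algebraic core
  have hcore := fewBody_algebraic_core (a := a) hD hm hgapη hP hNr hpairη hT0 hT0lam hlam3 hQ hS ht'
  -- `𝓔(θ) = 𝓔(η)` and the expansion of `∫ V θ² F²`
  have hDθ : dirichletFormW L (fun X => ‖Φ.ψ X‖) θ θ = D := by
    rw [hDdef]
    unfold dirichletFormW
    refine integral_congr_ae (ae_of_all _ fun X => ?_)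
    simp only [hηdef, gradDot_sub_const]
  have hVθ : ∫ X in cellN N L, V X * θ X ^ 2 * ‖Φ.ψ X‖ ^ 2 = a ^ 2 * S + 2 * a * P + Q := by
    have hexp : ∀ X, V X * θ X ^ 2 * ‖Φ.ψ X‖ ^ 2 =
        a ^ 2 * (V X * ‖Φ.ψ X‖ ^ 2) + 2 * a * (V X * η X * ‖Φ.ψ X‖ ^ 2) +
          V X * η X ^ 2 * ‖Φ.ψ X‖ ^ 2 := fun X => by
      simp only [hηdef]; ring
    have iA : IntegrableOn (fun X => a ^ 2 * (V X * ‖Φ.ψ X‖ ^ 2) + 2 * a * (V X * η X * ‖Φ.ψ X‖ ^ 2))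
        (cellN N L) := (iVF.const_mul _).add (iVηF.const_mul _)
    simp_rw [hexp]
    rw [integral_add iA iVη2F, integral_add (iVF.const_mul _) (iVηF.const_mul _), integral_const_mul,
      integral_const_mul]
  -- `a² ≤ ∫ θ² F²`
  have hmθ : m = (∫ X in cellN N L, θ X ^ 2 * ‖Φ.ψ X‖ ^ 2) - a ^ 2 := by
    rw [hmdef]
    exact integral_sub_mean_sq_mul Φ hreal hθc
  have ha2 : a ^ 2 ≤ ∫ X in cellN N L, θ X ^ 2 * ‖Φ.ψ X‖ ^ 2 := by linarith
  -- conclude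
  have hcoef : 0 ≤ 10 * t ^ 2 * N / psq L k := by positivity
  calc -(10 * t ^ 2 * N / psq L k) * ∫ X in cellN N L, θ X ^ 2 * ‖Φ.ψ X‖ ^ 2
      ≤ -(10 * t ^ 2 * N / psq L k) * a ^ 2 := by nlinarith
    _ ≤ D + t * (a ^ 2 * S + 2 * a * P + Q) := hcore
    _ = _ := by rw [hDθ, hVθ]


/-- **Registered form (`fewBody_perturbative_component`, helper of the lead's stub `stub_fewBodyBounded_of_parts`):**
`fewBody_perturbative_real` as a closed statement. [cite: ReedSimonIV1978, §XII.2; Kato1966, VII §4] -/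
theorem fewBody_perturbative_component :
    ∀ (w : ℝ → ℝ≥0∞) (N : ℕ) (L : ℝ), 0 < L → Measurable w →
      ∀ Φ : PeriodicTrialState N L, (∀ X, Φ.ψ X = (‖Φ.ψ X‖ : ℂ)) → (∀ X, Φ.ψ X ≠ 0) →
        periodicEnergy w Φ ≠ ⊤ → ∀ (k : Fin 3 → ℤ), k ≠ 0 → 0 < N → ∀ t : ℝ,
        (∀ η : Config N → ℝ, IsPeriodicTest L η →
          (∀ (σ : Equiv.Perm (Fin N)) (X : Config N), η (X ∘ σ) = η X) →
          (∫ X in cellN N L, η X * ‖Φ.ψ X‖ ^ 2) = 0 →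
          ((2 * Real.pi / L) ^ 2 - 2 * (periodicEnergy w Φ).toReal) *
              ∫ X in cellN N L, η X ^ 2 * ‖Φ.ψ X‖ ^ 2 ≤ dirichletFormW L (fun X => ‖Φ.ψ X‖) η η) →
        (∀ η : Config N → ℝ, IsPeriodicTest L η →
          psq L k * |∫ X in cellN N L,
              (∑ j, Real.cos (2 * Real.pi / L * ∑ i, (k i : ℝ) * X j i)) * η X * ‖Φ.ψ X‖ ^ 2|
            ≤ Real.sqrt (N * psq L k) * (Real.sqrt (dirichletFormW L (fun X => ‖Φ.ψ X‖) η η) +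
                2 * Real.sqrt (∫ X in cellN N L, η X ^ 2 * ‖Φ.ψ X‖ ^ 2) *
                  Real.sqrt (∫ X in cellN N L, gradDot (fun Y => ‖Φ.ψ Y‖) (fun Y => ‖Φ.ψ Y‖) X))) →
        0 ≤ t * cosMean L k Φ →
        5 * (periodicEnergy w Φ).toReal ≤ (2 * Real.pi / L) ^ 2 →
        2 * |t| * N ≤ (2 * Real.pi / L) ^ 2 - 2 * (periodicEnergy w Φ).toReal →
        ∀ θ : Config N → ℝ, IsPeriodicTest L θ →
          (∀ (σ : Equiv.Perm (Fin N)) (X : Config N), θ (X ∘ σ) = θ X) →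
          -(10 * t ^ 2 * N / psq L k) * ∫ X in cellN N L, θ X ^ 2 * ‖Φ.ψ X‖ ^ 2 ≤
            dirichletFormW L (fun X => ‖Φ.ψ X‖) θ θ +
              t * ∫ X in cellN N L,
                (∑ j, Real.cos (2 * Real.pi / L * ∑ i, (k i : ℝ) * X j i)) * θ X ^ 2 * ‖Φ.ψ X‖ ^ 2 :=
  fun _w _N _L hL hw _Φ hreal hpos hfin _k hk hN _t hgap hpair hsign hlam ht _θ hθ hθsymm =>
    fewBody_perturbative_real hL hw hreal hpos hfin hk hN hgap hpair hsign hlam ht hθ hθsymm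

end OneComponent

end Summit.AtomisticToContinuum.BoseEinsteinCondensation.Cruxes.StaticResponseBound.FewBody

end
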